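import Summits.AnomalousDissipation.AnomalousDissipation.Theorems.MarginalStabilityChainStrainedLayerLawSumRuleLine
import Literature.Analysis.FluidPDE.StretchedLayerStripCalculus
import Mathlib.MeasureTheory.Integral.Prod
import Mathlib.MeasureTheory.Integral.IntervalIntegral.IntegrationByParts
import Mathlib.MeasureTheory.Integral.IntegralEqImproper

/-!
# Crux `MarginalStabilityChain.StrainedLayerLaw` (stmt-AnomalousDissipation-3007), line
# `strain-work-sum-rule`: stub `stub_strainWorkMoment` — the strain work is minus the first
# `y`-moment of `ωu`

Support file (`--supports stmt-AnomalousDissipation-3007`) proving the registered stub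
`stub_strainWorkMoment` of the line BY NAME, with its signature verbatim: for ONE time slice
`(u, v)` of the class (`C²` jointly, divergence-free, `L`-periodic in `x`, with shear tails
`SliceTails C k u v`, `k > 0`) the strain work `J = strainWork L u v = ½∫∫(¼ − u² + v²)` equals
`−strainMoment L u v = −∫∫ y ω u`, `ω = ∂ₓv − ∂_yu` (iterated Bochner integrals over the period
strip, the objects of `…StrainedLayerLawSumRuleLine`).

Proof (two integrations by parts on the period strip `(0, L] × ℝ`, in product form, converted
to the iterated functionals by Fubini at the end):

* across the layer, for a bounded `C¹` field `g` with `∂_yg` and `g² − c` decaying like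
  `e^{−k|y|}`: `∫∫ y g ∂_yg = −∫∫ (g² − c)/2` (`y g ∂_yg = y ∂_y[(g² − c)/2]`, Mathlib's whole-line
  formula via `integral_strip_mul_dY_eq_neg`; used with `g = u, c = ¼` and `g = v, c = 0` — the
  far field is not needed, only the tails);
* along the layer: `∫∫ y u ∂ₓv = −∫∫ y ∂ₓu v` (periodicity, `integral_strip_mul_dX_eq_neg`)
  `= ∫∫ y v ∂_yv` (`∂ₓu = −∂_yv`) `= −∫∫ v²/2`;
* hence `∫∫ yωu = ∫∫ (y u ∂ₓv − y u ∂_yu) = −∫∫ v²/2 + ∫∫ (u² − ¼)/2 = −J`.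

The pointwise bounds come from `SliceTails`: `|v| ≤ Ce^{−k|y|}`, `|∇(u,v)| ≤ Ce^{−k|y|}`,
`v² ≤ C²e^{−k|y|}`, `|u² − ¼| ≤ (C + C²)e^{−k|y|}`, `|u| ≤ (¼ + C + C²)^{1/2}`; integrability on
the strip is `integrableOn_strip_of_abs_le_sq_exp` with the weight `(1 + |y|)² e^{−k|y|}`.

References: the line's vocabulary module `…StrainedLayerLawSumRuleLine` (`strainWork`,
`strainMoment`, `vorticity`, `SliceTails`); `Literature/Analysis/FluidPDE/StretchedLayerStripCalculus`
(strip measure, weights, the two integrations by parts); Majda–Bertozzi 2002 §1.4, §3.1.1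
(energy method on the period strip). All statements are folklore calculus.
-/

-- `Summit.<Summit>.<Problem>` is the tree's mandated summit-side namespace (CONVENTIONS §2); for this
-- single-conjunct summit the two coincide, so the duplicate is deliberate.
set_option linter.dupNamespace false

noncomputable section

open scoped Topology ENNReal
open Filter Set Function MeasureTheory

namespace Summit.AnomalousDissipation.AnomalousDissipation.Theorems.StrainedLayerLaw.StrainWorkSumRule

open Literature.Analysis.FluidPDE Literature.Analysis.FluidPDE.StretchedLayer

/-! ## Pointwise weight bookkeeping -/

/-- A decaying factor is dominated by the integrable weight:
`|b| ≤ B e^{−k|y|} ⇒ |b| ≤ B (1 + |y|)² e^{−k|y|}`. [folklore] -/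
private theorem abs_le_weight {y b B k : ℝ} (hb : |b| ≤ B * Real.exp (-k * |y|)) :
    |b| ≤ B * ((1 + |y|) ^ 2 * Real.exp (-k * |y|)) := by
  have h0 : 0 ≤ B * Real.exp (-k * |y|) := (abs_nonneg _).trans hb
  have hB : 0 ≤ B := le_of_mul_le_mul_right (by rwa [zero_mul]) (Real.exp_pos (-k * |y|))
  exact hb.trans (mul_le_mul_of_nonneg_left (exp_le_one_add_abs_sq_mul_exp k y) hB)

/-- `y` times a decaying factor: `|b| ≤ B e^{−k|y|} ⇒ |y| |b| ≤ B (1 + |y|)² e^{−k|y|}`. [folklore] -/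
private theorem abs_y_mul_le_weight {y b B k : ℝ} (hb : |b| ≤ B * Real.exp (-k * |y|)) :
    |y| * |b| ≤ B * ((1 + |y|) ^ 2 * Real.exp (-k * |y|)) := by
  have h0 : 0 ≤ B * Real.exp (-k * |y|) := (abs_nonneg _).trans hb
  have h1 : |y| ≤ (1 + |y|) ^ 2 := by nlinarith [abs_nonneg y]
  calc |y| * |b| ≤ (1 + |y|) ^ 2 * (B * Real.exp (-k * |y|)) :=
        mul_le_mul h1 hb (abs_nonneg _) (by positivity)
    _ = B * ((1 + |y|) ^ 2 * Real.exp (-k * |y|)) := by ring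

/-- `y` times a bounded factor times a decaying factor:
`|a| ≤ A`, `|b| ≤ B e^{−k|y|} ⇒ |y| |a| |b| ≤ A B (1 + |y|)² e^{−k|y|}`. [folklore] -/
private theorem abs_y_mul_mul_le_weight {y a b A B k : ℝ} (ha : |a| ≤ A)
    (hb : |b| ≤ B * Real.exp (-k * |y|)) :
    |y| * |a| * |b| ≤ A * B * ((1 + |y|) ^ 2 * Real.exp (-k * |y|)) := by
  have h1 := abs_y_mul_le_weight hb
  have hA : 0 ≤ A := (abs_nonneg _).trans ha
  have h2 : 0 ≤ |y| * |b| := mul_nonneg (abs_nonneg _) (abs_nonneg _)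
  calc |y| * |a| * |b| = |a| * (|y| * |b|) := by ring
    _ ≤ A * (B * ((1 + |y|) ^ 2 * Real.exp (-k * |y|))) := mul_le_mul ha h1 h2 hA
    _ = A * B * ((1 + |y|) ^ 2 * Real.exp (-k * |y|)) := by ring

/-! ## Integration by parts of `y g ∂_yg` across the layer -/

/-- `y g ∂_yg` is integrable on the strip when `g` is a bounded `C¹` field with decaying `∂_yg`.
[folklore] -/
private theorem integrableOn_y_mul_mul_dY {L k B D : ℝ} (hk : 0 < k) {g : ℝ → ℝ → ℝ}
    (hg : ContDiff ℝ 1 (fun q : ℝ × ℝ => g q.1 q.2)) (hb : ∀ x y, |g x y| ≤ B)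
    (hd : ∀ x y, |dY g x y| ≤ D * Real.exp (-k * |y|)) :
    IntegrableOn (fun q : ℝ × ℝ => q.2 * (g q.1 q.2 * dY g q.1 q.2)) (Ioc 0 L ×ˢ univ) :=
  integrableOn_strip_of_abs_le_sq_exp (continuous_snd.mul (hg.continuous.mul (continuous_dY hg)))
    hk fun x _ y => by
      rw [abs_mul, abs_mul, ← mul_assoc]
      exact abs_y_mul_mul_le_weight (hb x y) (hd x y)

/-- `(g² − c)/2` is integrable on the strip when it decays like `e^{−k|y|}`. [folklore] -/
private theorem integrableOn_half_sq_sub {L k E c : ℝ} (hk : 0 < k) {g : ℝ → ℝ → ℝ}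
    (hg : Continuous (fun q : ℝ × ℝ => g q.1 q.2))
    (hc : ∀ x y, |g x y ^ 2 - c| ≤ E * Real.exp (-k * |y|)) :
    IntegrableOn (fun q : ℝ × ℝ => (g q.1 q.2 ^ 2 - c) / 2) (Ioc 0 L ×ˢ univ) :=
  integrableOn_strip_of_abs_le_sq_exp (((hg.pow 2).sub continuous_const).div_const 2) hk
    fun x _ y => abs_le_weight (B := E / 2) (by have h := hc x y; rw [abs_div, abs_two]; linarith)

/-- `y (g² − c)/2` is integrable on the strip when `g² − c` decays like `e^{−k|y|}`. [folklore] -/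
private theorem integrableOn_y_mul_half_sq_sub {L k E c : ℝ} (hk : 0 < k) {g : ℝ → ℝ → ℝ}
    (hg : Continuous (fun q : ℝ × ℝ => g q.1 q.2))
    (hc : ∀ x y, |g x y ^ 2 - c| ≤ E * Real.exp (-k * |y|)) :
    IntegrableOn (fun q : ℝ × ℝ => q.2 * ((g q.1 q.2 ^ 2 - c) / 2)) (Ioc 0 L ×ˢ univ) :=
  integrableOn_strip_of_abs_le_sq_exp
    (continuous_snd.mul (((hg.pow 2).sub continuous_const).div_const 2)) hk fun x _ y => by
      rw [abs_mul]
      exact abs_y_mul_le_weight (B := E / 2) (by have h := hc x y; rw [abs_div, abs_two]; linarith)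

/-- **`∫∫ y g ∂_yg = −∫∫ (g² − c)/2` on the period strip** for a bounded `C¹` plane field `g`
whose `y`-derivative and whose `g² − c` decay like `e^{−k|y|}` (`k > 0`): integration by parts
across the layer, `y g ∂_yg = y ∂_y[(g² − c)/2]`, the boundary term `y (g² − c)/2 → 0` being
encoded in the integrability of the three products (Mathlib's whole-line formula, through
`integral_strip_mul_dY_eq_neg`). [folklore] -/
private theorem integral_strip_y_mul_mul_dY {L k B D E : ℝ} (c : ℝ) (hk : 0 < k)
    {g : ℝ → ℝ → ℝ} (hg : ContDiff ℝ 1 (fun q : ℝ × ℝ => g q.1 q.2)) (hb : ∀ x y, |g x y| ≤ B)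
    (hd : ∀ x y, |dY g x y| ≤ D * Real.exp (-k * |y|))
    (hc : ∀ x y, |g x y ^ 2 - c| ≤ E * Real.exp (-k * |y|)) :
    ∫ q in Ioc 0 L ×ˢ univ, q.2 * (g q.1 q.2 * dY g q.1 q.2) =
      -∫ q in Ioc 0 L ×ˢ univ, (g q.1 q.2 ^ 2 - c) / 2 := by
  have hgd : ∀ x y, HasDerivAt (fun s => (g x s ^ 2 - c) / 2) (g x y * dY g x y) y :=
    fun x y =>
      ((((hasDerivAt_dY_of_contDiff hg one_ne_zero x y).fun_pow 2).sub_const c).div_const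
        2).congr_deriv (by norm_num; ring)
  have h := integral_strip_mul_dY_eq_neg (L := L) (f := fun _ y => y) (f' := fun _ _ => (1 : ℝ))
    (g := fun x y => (g x y ^ 2 - c) / 2) (g' := fun x y => g x y * dY g x y)
    (fun _ y => hasDerivAt_id' y) hgd (integrableOn_y_mul_mul_dY hk hg hb hd)
    (by simpa only [one_mul] using integrableOn_half_sq_sub hk hg.continuous hc)
    (integrableOn_y_mul_half_sq_sub hk hg.continuous hc)
  simpa only [one_mul] using h

/-! ## The stub -/

/-- **Registered stub `stub_strainWorkMoment` of the line `strain-work-sum-rule` (crux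
`StrainedLayerLaw`, stmt-AnomalousDissipation-3007): the strain work is minus the first
`y`-moment of `ωu`.** For one time slice `(u, v)` — `C²` jointly, divergence-free, `L`-periodic
in `x` (`L > 0`), with shear tails `SliceTails C k u v` (`k > 0`) —
`strainWork L u v = −strainMoment L u v`, i.e. `½∫∫(¼ − u² + v²) = −∫∫ y(∂ₓv − ∂_yu)u`:
`∫∫ y u ∂_yu = −∫∫ (u² − ¼)/2` and `∫∫ y u ∂ₓv = −∫∫ y ∂ₓu v = ∫∫ y v ∂_yv = −∫∫ v²/2`
(two integrations by parts on the period strip; the far field is not needed). [folklore] -/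
theorem stub_strainWorkMoment : ∀ (L C k : ℝ), 0 < L → 0 < k → ∀ (u v : ℝ → ℝ → ℝ),
    ContDiff ℝ 2 (fun q : ℝ × ℝ => u q.1 q.2) → ContDiff ℝ 2 (fun q : ℝ × ℝ => v q.1 q.2) →
    (∀ x y, dX u x y + dY v x y = 0) →
    (∀ x y, u (x + L) y = u x y) → (∀ x y, v (x + L) y = v x y) →
    SliceTails C k u v →
      strainWork L u v = -strainMoment L u v := by
  intro L C k hL hk u v hu hv hdiv hpu hpv hT
  -- regularity
  have hu1 : ContDiff ℝ 1 (fun q : ℝ × ℝ => u q.1 q.2) := hu.of_le one_le_two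
  have hv1 : ContDiff ℝ 1 (fun q : ℝ × ℝ => v q.1 q.2) := hv.of_le one_le_two
  have huc : Continuous (fun q : ℝ × ℝ => u q.1 q.2) := hu.continuous
  have hvc : Continuous (fun q : ℝ × ℝ => v q.1 q.2) := hv.continuous
  -- pointwise bounds from the shear tails
  have he1 : ∀ y : ℝ, Real.exp (-k * |y|) ≤ 1 := fun y =>
    Real.exp_le_one_iff.2 (by nlinarith [abs_nonneg y])
  have hC : 0 ≤ C := by
    have h := (abs_nonneg _).trans (hT 0 0).2.1
    rwa [abs_zero, mul_zero, Real.exp_zero, mul_one] at h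
  have hvE : ∀ x y, |v x y| ≤ C * Real.exp (-k * |y|) := fun x y => (hT x y).2.1
  have hvB : ∀ x y, |v x y| ≤ C := fun x y => (hvE x y).trans (mul_le_of_le_one_right hC (he1 y))
  have hgrad : ∀ x y, |dX u x y| ≤ C * Real.exp (-k * |y|) ∧ |dY u x y| ≤ C * Real.exp (-k * |y|) ∧
      |dX v x y| ≤ C * Real.exp (-k * |y|) ∧ |dY v x y| ≤ C * Real.exp (-k * |y|) := fun x y => by
    have h := (hT x y).2.2.1
    have h1 := abs_nonneg (dX u x y)
    have h2 := abs_nonneg (dY u x y)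
    have h3 := abs_nonneg (dX v x y)
    have h4 := abs_nonneg (dY v x y)
    exact ⟨by linarith, by linarith, by linarith, by linarith⟩
  have hdXuB : ∀ x y, |dX u x y| ≤ C := fun x y =>
    (hgrad x y).1.trans (mul_le_of_le_one_right hC (he1 y))
  have hv2 : ∀ x y, |v x y ^ 2 - 0| ≤ C ^ 2 * Real.exp (-k * |y|) := fun x y => by
    have h1 := hvE x y
    have h0 : 0 ≤ C * Real.exp (-k * |y|) := (abs_nonneg _).trans h1
    calc |v x y ^ 2 - 0| = |v x y| * |v x y| := by rw [sub_zero, abs_pow, sq]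
      _ ≤ C * Real.exp (-k * |y|) * (C * Real.exp (-k * |y|)) := mul_le_mul h1 h1 (abs_nonneg _) h0
      _ = C ^ 2 * Real.exp (-k * |y|) * Real.exp (-k * |y|) := by ring
      _ ≤ C ^ 2 * Real.exp (-k * |y|) := mul_le_of_le_one_right (by positivity) (he1 y)
  have hu2 : ∀ x y, |u x y ^ 2 - 1 / 4| ≤ (C + C ^ 2) * Real.exp (-k * |y|) := fun x y => by
    calc |u x y ^ 2 - 1 / 4| = |(u x y ^ 2 + v x y ^ 2 - 1 / 4) - (v x y ^ 2 - 0)| := by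
          congr 1; ring
      _ ≤ |u x y ^ 2 + v x y ^ 2 - 1 / 4| + |v x y ^ 2 - 0| := abs_sub _ _
      _ ≤ C * Real.exp (-k * |y|) + C ^ 2 * Real.exp (-k * |y|) := add_le_add (hT x y).1 (hv2 x y)
      _ = (C + C ^ 2) * Real.exp (-k * |y|) := by ring
  have huB : ∀ x y, |u x y| ≤ Real.sqrt (1 / 4 + (C + C ^ 2)) := fun x y => by
    refine Real.abs_le_sqrt ?_
    have h := (le_abs_self _).trans ((hu2 x y).trans
      (mul_le_of_le_one_right (add_nonneg hC (sq_nonneg C)) (he1 y)))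
    linarith
  -- (A) across the layer: `∫∫ y u ∂_yu = -∫∫ (u² - 1/4)/2`, `∫∫ y v ∂_yv = -∫∫ (v² - 0)/2`
  have hAu := integral_strip_y_mul_mul_dY (L := L) (1 / 4) hk hu1 huB (fun x y => (hgrad x y).2.1) hu2
  have hAv := integral_strip_y_mul_mul_dY (L := L) 0 hk hv1 hvB (fun x y => (hgrad x y).2.2.2) hv2
  -- (B) along the layer: `∫∫ y u ∂ₓv = -∫∫ y ∂ₓu v = ∫∫ y v ∂_yv`
  have hI1 : IntegrableOn (fun q : ℝ × ℝ => q.2 * u q.1 q.2 * dX v q.1 q.2) (Ioc 0 L ×ˢ univ) :=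
    integrableOn_strip_of_abs_le_sq_exp ((continuous_snd.mul huc).mul (continuous_dX hv1)) hk
      fun x _ y => by
        rw [abs_mul, abs_mul]
        exact abs_y_mul_mul_le_weight (huB x y) (hgrad x y).2.2.1
  have hI2 : IntegrableOn (fun q : ℝ × ℝ => q.2 * dX u q.1 q.2 * v q.1 q.2) (Ioc 0 L ×ˢ univ) :=
    integrableOn_strip_of_abs_le_sq_exp ((continuous_snd.mul (continuous_dX hu1)).mul hvc) hk
      fun x _ y => by
        rw [abs_mul, abs_mul]
        exact abs_y_mul_mul_le_weight (hdXuB x y) (hvE x y)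
  have hB : ∫ q in Ioc 0 L ×ˢ univ, q.2 * u q.1 q.2 * dX v q.1 q.2 =
      -∫ q in Ioc 0 L ×ˢ univ, q.2 * dX u q.1 q.2 * v q.1 q.2 :=
    integral_strip_mul_dX_eq_neg hL.le (f := fun x y => y * u x y) (f' := fun x y => y * dX u x y)
      (fun x y => (hasDerivAt_dX_of_contDiff hu two_ne_zero x y).const_mul y)
      (hasDerivAt_dX_of_contDiff hv two_ne_zero)
      (fun y => continuous_const.mul (continuous_slice_x (continuous_dX hu1) y))
      (continuous_slice_x (continuous_dX hv1))
      (fun y => by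
        rw [show u L y = u 0 y by simpa using hpu 0 y, show v L y = v 0 y by simpa using hpv 0 y])
      hI1 hI2
  have hB' : -∫ q in Ioc 0 L ×ˢ univ, q.2 * dX u q.1 q.2 * v q.1 q.2 =
      ∫ q in Ioc 0 L ×ˢ univ, q.2 * (v q.1 q.2 * dY v q.1 q.2) := by
    rw [← integral_neg]
    refine integral_congr_ae (Eventually.of_forall fun q => ?_)
    have h := hdiv q.1 q.2
    simp only
    linear_combination (-(q.2 * v q.1 q.2)) * h
  -- (C) the iterated functionals are the strip integrals (Fubini)
  have hI3 := integrableOn_y_mul_mul_dY (L := L) hk hu1 huB (fun x y => (hgrad x y).2.1)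
  have hI5 := integrableOn_half_sq_sub (L := L) hk huc hu2
  have hI6 := integrableOn_half_sq_sub (L := L) hk hvc hv2
  have hIW : IntegrableOn (fun q : ℝ × ℝ => (1 / 4 - u q.1 q.2 ^ 2 + v q.1 q.2 ^ 2) / 2)
      (Ioc 0 L ×ˢ univ) :=
    (hI6.sub hI5).congr_fun (fun q _ => by simp only [Pi.sub_apply]; ring)
      (measurableSet_Ioc.prod MeasurableSet.univ)
  have hIM : IntegrableOn (fun q : ℝ × ℝ => q.2 * vorticity u v q.1 q.2 * u q.1 q.2)
      (Ioc 0 L ×ˢ univ) :=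
    (hI1.sub hI3).congr_fun (fun q _ => by simp only [Pi.sub_apply, vorticity]; ring)
      (measurableSet_Ioc.prod MeasurableSet.univ)
  have hSW : strainWork L u v =
      ∫ q in Ioc 0 L ×ˢ univ, (1 / 4 - u q.1 q.2 ^ 2 + v q.1 q.2 ^ 2) / 2 := by
    rw [IntegrableOn, volume_restrict_strip] at hIW
    rw [volume_restrict_strip, integral_prod _ hIW]
    rfl
  have hSM : strainMoment L u v =
      ∫ q in Ioc 0 L ×ˢ univ, q.2 * vorticity u v q.1 q.2 * u q.1 q.2 := by
    rw [IntegrableOn, volume_restrict_strip] at hIM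
    rw [volume_restrict_strip, integral_prod _ hIM]
    rfl
  -- (D) assemble
  have hW : ∫ q in Ioc 0 L ×ˢ univ, (1 / 4 - u q.1 q.2 ^ 2 + v q.1 q.2 ^ 2) / 2 =
      (∫ q in Ioc 0 L ×ˢ univ, (v q.1 q.2 ^ 2 - 0) / 2) -
        ∫ q in Ioc 0 L ×ˢ univ, (u q.1 q.2 ^ 2 - 1 / 4) / 2 := by
    rw [← integral_sub hI6 hI5]
    refine integral_congr_ae (Eventually.of_forall fun q => ?_)
    simp only
    ring
  have hM : ∫ q in Ioc 0 L ×ˢ univ, q.2 * vorticity u v q.1 q.2 * u q.1 q.2 =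
      (∫ q in Ioc 0 L ×ˢ univ, q.2 * u q.1 q.2 * dX v q.1 q.2) -
        ∫ q in Ioc 0 L ×ˢ univ, q.2 * (u q.1 q.2 * dY u q.1 q.2) := by
    rw [← integral_sub hI1 hI3]
    refine integral_congr_ae (Eventually.of_forall fun q => ?_)
    simp only [vorticity]
    ring
  rw [hSW, hSM, hW, hM, hB, hB', hAv, hAu]
  ring

end Summit.AnomalousDissipation.AnomalousDissipation.Theorems.StrainedLayerLaw.StrainWorkSumRule

end
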